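import Mathlib
import Literature.LinearAlgebra.Matrix.BipartiteForestFormula

/-!
# Principal cofactors of the doubled forest matrix: the pointed forest sum

Continuation of `Literature/LinearAlgebra/Matrix/BipartiteForestFormula.lean` (the bipartite all-minors
matrix-forest formula over `𝔽₂`, [Chaiken1982, §2]): for arc weights `a`, a vertex set `D`, marks
`y`, roots `z`, extra roots `ℓ` and the doubled matrix `N = bigN a D y z ℓ = [[D_y, Pᵀ],[P, D_z]]`,
`det N = setExp (fwt a y z ℓ) D = Σ_π ∏_{B ∈ π} ((Σ_B y) q_z(B) + q_ℓ(B))`.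

Since `det N` is affine in each mark `y_j`, its slope — the principal cofactor `adj(N)_{(inl j),(inl j)}`
(the minor deleting the MARK copy of `j`) — is the POINTED forest sum in which the block of `j` is
weighted by `q_z` alone:
* `det_bigN_update_mark` — `det N(y + c e_j) = det N(y) + c · adj(N)_{jj}` (row linearity);
* `setExp_fwt_update_mark` — the same shift on the forest side (peel the block of `j`);
* `adjugate_bigN_inl_inl` — **`adj(N)_{(inl j)(inl j)} = Σ_{B₀ ⊆ D∖j} q_z({j} ∪ B₀) · setExp(fwt)(D∖j∖B₀)`**;
* `sum_mul_adjugate_bigN_inl` — weighting by `x_j` and summing over `j`: the pointed sum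
  `Σ_{B ⊆ D} (Σ_B x) q_z(B) · setExp(fwt)(D∖B)` (Chaiken's forests with one distinguished tree);
* `sum_mul_adjugate_bigN_zero_inl` — at `y = 0`, `ℓ = z` the pointing weight is additive over an
  unpointed product, so `Σ_j w_j adj(N)_{jj} = (Σ_D w) · det N` (`setExp_point`).
These feed the forest proofs of Smith 2016, Thm. 2.2 rows 2 and 3 [Smith2016CongruentDensity, §2.2]
(bordered determinants `O(A, z, u)` = one distinguished block).
-/

namespace Literature.LinearAlgebra.Matrix

open _root_.Matrix Finset Literature.Combinatorics.Enumerative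

variable {V : Type*} [Fintype V] [LinearOrder V]

/-- With no marks the block weight is `q_ℓ` (whatever the `z`-roots). [cite: ChebotarevAgaev2002, §3 Thm. 2] -/
theorem fwt_zero_left (a : V → V → ZMod 2) (z ℓ : V → ZMod 2) : fwt a 0 z ℓ = qwt a ℓ := by
  funext B
  simp [fwt]

omit [Fintype V] in
/-- **Raising one mark.** For `j ∈ D`, replacing `y_j` by `y_j + c` replaces row `inl j` of the doubled
matrix by itself plus `c · e_{inl j}` (only the diagonal entry `(inl j, inl j)` moves).
[cite: Chaiken1982, §2 (the variables attached to the vertices of U)] -/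
theorem bigN_update_mark (a : V → V → ZMod 2) {D : Finset V} {j : V} (hj : j ∈ D)
    (y z ℓ : V → ZMod 2) (c : ZMod 2) :
    bigN a D (Function.update y j (y j + c)) z ℓ =
      (bigN a D y z ℓ).updateRow (Sum.inl j)
        ((bigN a D y z ℓ) (Sum.inl j) + c • (Pi.single (Sum.inl j) (1 : ZMod 2) : V ⊕ V → ZMod 2)) := by
  ext (i | i) (k | k)
  · rw [updateRow_apply, bigN_inl_inl]
    by_cases hij : i = j
    · subst hij
      rw [if_pos rfl, Pi.add_apply, Pi.smul_apply, bigN_inl_inl, if_pos hj, if_pos hj,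
        Function.update_self]
      by_cases hik : i = k
      · subst hik; simp
      · have : (Sum.inl k : V ⊕ V) ≠ Sum.inl i := fun h => hik (Sum.inl_injective h).symm
        simp [hik, this]
    · have hne : (Sum.inl i : V ⊕ V) ≠ Sum.inl j := fun h => hij (Sum.inl_injective h)
      rw [if_neg hne, bigN_inl_inl, Function.update_of_ne hij]
  · rw [updateRow_apply, bigN_inl_inr]
    by_cases hij : i = j
    · subst hij
      rw [if_pos rfl, Pi.add_apply, Pi.smul_apply, bigN_inl_inr]
      simp
    · have hne : (Sum.inl i : V ⊕ V) ≠ Sum.inl j := fun h => hij (Sum.inl_injective h)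
      rw [if_neg hne, bigN_inl_inr]
  · rw [updateRow_ne (Sum.inr_ne_inl), bigN_inr_inl, bigN_inr_inl]
  · rw [updateRow_ne (Sum.inr_ne_inl), bigN_inr_inr, bigN_inr_inr]

/-- **`det N` is affine in each mark**, with slope the principal cofactor of the mark copy:
`det N(y + c e_j) = det N(y) + c · adj(N)_{(inl j),(inl j)}`.
[cite: Chaiken1982, §2 (all minors matrix tree theorem: the coefficient of a vertex variable is a minor)] -/
theorem det_bigN_update_mark (a : V → V → ZMod 2) {D : Finset V} {j : V} (hj : j ∈ D)
    (y z ℓ : V → ZMod 2) (c : ZMod 2) :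
    (bigN a D (Function.update y j (y j + c)) z ℓ).det =
      (bigN a D y z ℓ).det + c * (bigN a D y z ℓ).adjugate (Sum.inl j) (Sum.inl j) := by
  rw [bigN_update_mark a hj, det_updateRow_add, updateRow_eq_self, det_updateRow_smul,
    adjugate_apply]

/-- **The same shift on the forest side**: raising `y_j` by `c` adds `c · q_z(B)` to the weight of
the block `B ∋ j` and leaves all other blocks alone, so
`setExp(fwt(y + c e_j)) D = setExp(fwt y) D + c · Σ_{B₀ ⊆ D∖j} q_z({j} ∪ B₀) · setExp(fwt y)(D∖j∖B₀)`.
[cite: Chaiken1982, §2] [cite: Stanley1999EC2, Cor. 5.1.6 (exponential formula; elementary finite form)] -/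
theorem setExp_fwt_update_mark (a : V → V → ZMod 2) {D : Finset V} {j : V} (hj : j ∈ D)
    (y z ℓ : V → ZMod 2) (c : ZMod 2) :
    setExp (fwt a (Function.update y j (y j + c)) z ℓ) D =
      setExp (fwt a y z ℓ) D +
        c * ∑ B₀ ∈ (D.erase j).powerset, qwt a z (insert j B₀) * setExp (fwt a y z ℓ) (D.erase j \ B₀) := by
  rw [setExp_peel _ hj, setExp_peel (fwt a y z ℓ) hj, mul_sum, ← sum_add_distrib]
  refine sum_congr rfl fun B₀ hB₀ => ?_
  rw [mem_powerset] at hB₀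
  have hjB₀ : j ∉ B₀ := fun h => notMem_erase j D (hB₀ h)
  -- the blocks avoiding `j` do not see the new mark
  have hrest : setExp (fwt a (Function.update y j (y j + c)) z ℓ) (D.erase j \ B₀) =
      setExp (fwt a y z ℓ) (D.erase j \ B₀) := by
    refine setExp_congr fun C hC _ => fwt_congr (fun _ _ _ _ _ => rfl) (fun i hi => ?_)
    have hij : i ≠ j := fun h => notMem_erase j D ((mem_sdiff.mp (hC hi)).1 |> (h ▸ ·))
    exact Function.update_of_ne hij _ _
  -- the block of `j` gains `c · q_z`
  have hblock : fwt a (Function.update y j (y j + c)) z ℓ (insert j B₀) =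
      fwt a y z ℓ (insert j B₀) + c * qwt a z (insert j B₀) := by
    unfold fwt
    rw [sum_insert hjB₀, sum_insert hjB₀, Function.update_self,
      sum_congr rfl fun i hi => Function.update_of_ne (ne_of_mem_of_not_mem hi hjB₀) _ _]
    ring
  rw [hrest, hblock]
  ring

/-- **The principal cofactor of a mark copy is the pointed forest sum**: for `j ∈ D`,
`adj(N)_{(inl j),(inl j)} = Σ_{B₀ ⊆ D∖j} q_z({j} ∪ B₀) · setExp(fwt a y z ℓ)(D∖j∖B₀)` — forests in
which the tree containing `j` carries a `z`-root but no mark.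
[cite: Chaiken1982, §2 (all minors matrix tree theorem, the minor deleting one vertex of U)] -/
theorem adjugate_bigN_inl_inl (a : V → V → ZMod 2) {D : Finset V} {j : V} (hj : j ∈ D)
    (y z ℓ : V → ZMod 2) :
    (bigN a D y z ℓ).adjugate (Sum.inl j) (Sum.inl j) =
      ∑ B₀ ∈ (D.erase j).powerset, qwt a z (insert j B₀) * setExp (fwt a y z ℓ) (D.erase j \ B₀) := by
  have h1 := det_bigN_update_mark a hj y z ℓ 1
  rw [det_bigN_eq_setExp, det_bigN_eq_setExp, setExp_fwt_update_mark a hj y z ℓ 1, one_mul,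
    one_mul] at h1
  exact (add_left_cancel h1).symm

omit [Fintype V] in
/-- Set bookkeeping: `(D ∖ j) ∖ B₀ = D ∖ ({j} ∪ B₀)`. [cite: Stanley1999EC2, Cor. 5.1.6 (exponential formula; elementary finite form)] -/
theorem erase_sdiff_eq_sdiff_insert (D B₀ : Finset V) (j : V) :
    D.erase j \ B₀ = D \ insert j B₀ := by
  ext x; simp only [mem_sdiff, mem_erase, mem_insert]; tauto

/-- **The pointed forest sum with an additive pointing weight**:
`Σ_{j ∈ D} x_j · adj(N)_{(inl j),(inl j)} = Σ_{B ⊆ D} (Σ_{i∈B} x_i) · q_z(B) · setExp(fwt)(D ∖ B)`.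
[cite: Chaiken1982, §2] [cite: Smith2016CongruentDensity, §2.2 (chunk p0008 L42: the bordered determinant as Σ_S det O(A,z,u)[S] · det M₁[S′])] -/
theorem sum_mul_adjugate_bigN_inl (a : V → V → ZMod 2) (D : Finset V) (y z ℓ x : V → ZMod 2) :
    ∑ j ∈ D, x j * (bigN a D y z ℓ).adjugate (Sum.inl j) (Sum.inl j) =
      ∑ B ∈ D.powerset, (∑ i ∈ B, x i) * qwt a z B * setExp (fwt a y z ℓ) (D \ B) := by
  have hj : ∀ j ∈ D, x j * (bigN a D y z ℓ).adjugate (Sum.inl j) (Sum.inl j) =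
      ∑ B₀ ∈ (D.erase j).powerset,
        x j * (qwt a z (insert j B₀) * setExp (fwt a y z ℓ) (D \ insert j B₀)) := by
    intro j hj
    rw [adjugate_bigN_inl_inl a hj, mul_sum]
    exact sum_congr rfl fun B₀ _ => by rw [erase_sdiff_eq_sdiff_insert]
  rw [sum_congr rfl hj, sum_sum_powerset_erase_insert D
    (fun j B => x j * (qwt a z B * setExp (fwt a y z ℓ) (D \ B)))]
  refine sum_congr rfl fun B _ => ?_
  rw [sum_mul, sum_mul]
  exact sum_congr rfl fun j _ => by ring

/-- **Unmarked doubled matrix, additive pointing**: at `y = 0` and `ℓ = z` the block weight is `q_z`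
itself, so pointing one block by `Σ_B w` and summing returns the total weight:
`Σ_{j ∈ D} w_j · adj(N)_{(inl j),(inl j)} = (Σ_D w) · det N` for `N = bigN a D 0 z z`.
[cite: Chaiken1982, §2] [cite: Stanley1999EC2, Cor. 5.1.6 (pointing a block of the exponential formula)] -/
theorem sum_mul_adjugate_bigN_zero_inl (a : V → V → ZMod 2) (D : Finset V) (z w : V → ZMod 2) :
    ∑ j ∈ D, w j * (bigN a D 0 z z).adjugate (Sum.inl j) (Sum.inl j) =
      (∑ i ∈ D, w i) * (bigN a D 0 z z).det := by
  rw [sum_mul_adjugate_bigN_inl, det_bigN_eq_setExp, fwt_zero_left, ← setExp_point w (qwt a z) D]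
  exact sum_congr rfl fun B _ => by ring

end Literature.LinearAlgebra.Matrix
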